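import Summits.CriticalPhenomena.PercolationContinuityZ3.Theorems.SahiMasterFamilyPointwiseSharedFaceVanishing

/-!
# Shared-face-vanishing families: the dependence criterion by sections, DECREASING events, and the graph form (`k ≤ 6`)

Unit `prim-master-conj` (crux anchor stmt-CriticalPhenomena-4575, helper work), gen 13; companion of `…PointwiseSharedFaceVanishing`.
* `affects_iff_secAt_ne` — an increasing event depends on `e` (`Affects`) iff its two `e`-sections differ; this form makes sense for decreasing events too
  and is invariant under complementing configurations (`secAt_ne_iff_preimage_compl`).
* `sahiE_ind_lower_nonneg_of_sharedFaceVanishing`, `sahiE_ind_lower_eq_zero_iff_of_sharedFaceVanishing`, `…_pos_…` — for `k = n+2 ≤ 6` DECREASING events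
  such that at every coordinate on which at least two members depend both one-coordinate minors are zero flags: `C_k` at every `p`, and at interior `p`
  `E_k(μ_p; 1_D) = 0 ↔ D ∈ Z_k`, `> 0` otherwise (complementation transfer of the increasing theorem);
* GRAPH FORM (`sahiE_groupSep_…_of_sharedFaceVanishing`) — for `k = n+2 ≤ 6` group separations `{X_j ↮ Y_j}` on a finite graph such that at every EDGE that
  is pivotal for at least two of them both single-edge minors form a zero flag: `E_k(μ_w) ≥ 0` for every weight vector and, at interior `w`,
  `E_k(μ_w) = 0` iff the tuple is a zero flag.
Axioms standard. [this work]
-/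

noncomputable section

open scoped Classical
open scoped unitInterval

namespace Summit.CriticalPhenomena.PercolationContinuityZ3.Theorems

open Finset Function
open Literature.Combinatorics.Sahi2008
open Literature.Probability.LatticeModels (isUpperSet_preimage_compl)
open Literature.Probability.LatticeModels.Kahn2022 (Affects)
open Literature.Probability.Percolation (DeterminedBy determinedBy_iff)
open Literature.Probability.Percolation.DecisionTree (ind)

namespace Pointwise

variable {ι : Type} [Fintype ι]

/-! ### 1. Dependence by sections -/

omit [Fintype ι] in
/-- **An increasing event depends on `e` iff its two `e`-sections differ.** [this work] -/
theorem affects_iff_secAt_ne {A : Set (Set ι)} (hA : IsUpperSet A) (e : ι) : Affects A e ↔ secAt e false A ≠ secAt e true A := by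
  constructor
  · rintro ⟨ω, hω, heω⟩ heq
    have h1 : ω ∈ secAt e true A := by rw [mem_secAt]; exact heω
    have h0 : ω ∉ secAt e false A := by
      rw [mem_secAt]
      exact fun h => hω (hA Set.sdiff_subset h)
    exact h0 (heq ▸ h1)
  · intro hne
    by_contra hAff
    exact hne (by rw [secAt_eq_self_of_not_affects hA hAff false, secAt_eq_self_of_not_affects hA hAff true])

omit [Fintype ι] in
/-- Complementation is injective on events. [folklore] -/
theorem preimage_compl_injective {X Y : Set (Set ι)} (h : compl ⁻¹' X = compl ⁻¹' Y) : X = Y := by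
  have hX : compl ⁻¹' (compl ⁻¹' X) = X := by ext ω; simp
  have hY : compl ⁻¹' (compl ⁻¹' Y) = Y := by ext ω; simp
  rw [← hX, ← hY, h]

omit [Fintype ι] in
/-- **Dependence is invariant under complementing configurations**: the `e`-sections of `D` differ iff those of `compl ⁻¹' D` do. [this work] -/
theorem secAt_ne_iff_preimage_compl (e : ι) (D : Set (Set ι)) :
    secAt e false D ≠ secAt e true D ↔ secAt e false (compl ⁻¹' D) ≠ secAt e true (compl ⁻¹' D) := by
  have h0 : secAt e false (compl ⁻¹' D) = compl ⁻¹' secAt e true D := by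
    rw [preimage_compl_secAt]; rfl
  have h1 : secAt e true (compl ⁻¹' D) = compl ⁻¹' secAt e false D := by
    rw [preimage_compl_secAt]; rfl
  rw [h0, h1]
  constructor
  · exact fun hne heq => hne (preimage_compl_injective heq).symm
  · exact fun hne heq => hne (by rw [heq])

/-- The increasing theorem with dependence stated by sections. [this work] -/
theorem sahiE_ind_nonneg_and_eq_zero_iff_of_sharedFaceVanishing' {n : ℕ} (hn : n + 2 ≤ 6) (p : ι → unitInterval)
    (hp : ∀ e, (p e : ℝ) ∈ Set.Ioo (0 : ℝ) 1) (U : Fin (n + 2) → Set (Set ι)) (hU : ∀ j, IsUpperSet (U j))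
    (hsh : ∀ e, (∃ i j, i ≠ j ∧ secAt e false (U i) ≠ secAt e true (U i) ∧ secAt e false (U j) ≠ secAt e true (U j)) →
      ∀ b : Bool, SuppZeroFlag (n + 2) (fun j => secAt e b (U j))) :
    0 ≤ sahiE (bernoulliWeight p) (n + 2) (fun j => ind (U j)) ∧
      (sahiE (bernoulliWeight p) (n + 2) (fun j => ind (U j)) = 0 ↔ SuppZeroFlag (n + 2) U) :=
  sahiE_ind_nonneg_and_eq_zero_iff_of_sharedFaceVanishing hn p hp _ U rfl hU fun e ⟨i, j, hij, hi, hj⟩ b =>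
    hsh e ⟨i, j, hij, (affects_iff_secAt_ne (hU i) e).1 hi, (affects_iff_secAt_ne (hU j) e).1 hj⟩ b

/-! ### 2. Decreasing families -/

/-- **Shared-face-vanishing DECREASING families, `k = n+2 ≤ 6`**: `C_k` at interior `p` and the pointwise statement. [this work] -/
theorem sahiE_ind_lower_nonneg_and_eq_zero_iff_of_sharedFaceVanishing {n : ℕ} (hn : n + 2 ≤ 6) (p : ι → unitInterval)
    (hp : ∀ e, (p e : ℝ) ∈ Set.Ioo (0 : ℝ) 1) (D : Fin (n + 2) → Set (Set ι)) (hD : ∀ j, IsLowerSet (D j))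
    (hsh : ∀ e, (∃ i j, i ≠ j ∧ secAt e false (D i) ≠ secAt e true (D i) ∧ secAt e false (D j) ≠ secAt e true (D j)) →
      ∀ b : Bool, SuppZeroFlag (n + 2) (fun j => secAt e b (D j))) :
    0 ≤ sahiE (bernoulliWeight p) (n + 2) (fun j => ind (D j)) ∧
      (sahiE (bernoulliWeight p) (n + 2) (fun j => ind (D j)) = 0 ↔ SuppZeroFlag (n + 2) D) := by
  rw [sahiE_ind_eq_sahiE_ind_preimage_compl, ← suppZeroFlag_preimage_compl_iff (n + 2) D]
  refine sahiE_ind_nonneg_and_eq_zero_iff_of_sharedFaceVanishing' hn _ ((symm_mem_Ioo_iff p).2 hp) (fun j => compl ⁻¹' D j)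
    (fun j => isUpperSet_preimage_compl (hD j)) fun e ⟨i, j, hij, hi, hj⟩ b => ?_
  have hZ := hsh e ⟨i, j, hij, (secAt_ne_iff_preimage_compl e (D i)).2 hi, (secAt_ne_iff_preimage_compl e (D j)).2 hj⟩ (!b)
  have h := (suppZeroFlag_preimage_compl_iff (n + 2) (fun j => secAt e (!b) (D j))).2 hZ
  have hfam : (fun j => compl ⁻¹' secAt e (!b) (D j)) = fun j => secAt e b (compl ⁻¹' D j) := by
    funext j; rw [preimage_compl_secAt, Bool.not_not]
  rwa [hfam] at h

/-- `C_k` (interior `p`) for shared-face-vanishing decreasing families, `k = n+2 ≤ 6`. [this work] -/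
theorem sahiE_ind_lower_nonneg_of_sharedFaceVanishing {n : ℕ} (hn : n + 2 ≤ 6) (p : ι → unitInterval)
    (hp : ∀ e, (p e : ℝ) ∈ Set.Ioo (0 : ℝ) 1) (D : Fin (n + 2) → Set (Set ι)) (hD : ∀ j, IsLowerSet (D j))
    (hsh : ∀ e, (∃ i j, i ≠ j ∧ secAt e false (D i) ≠ secAt e true (D i) ∧ secAt e false (D j) ≠ secAt e true (D j)) →
      ∀ b : Bool, SuppZeroFlag (n + 2) (fun j => secAt e b (D j))) :
    0 ≤ sahiE (bernoulliWeight p) (n + 2) (fun j => ind (D j)) :=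
  (sahiE_ind_lower_nonneg_and_eq_zero_iff_of_sharedFaceVanishing hn p hp D hD hsh).1

/-- Pointwise statement for shared-face-vanishing decreasing families, `k = n+2 ≤ 6`. [this work] -/
theorem sahiE_ind_lower_eq_zero_iff_of_sharedFaceVanishing {n : ℕ} (hn : n + 2 ≤ 6) (p : ι → unitInterval)
    (hp : ∀ e, (p e : ℝ) ∈ Set.Ioo (0 : ℝ) 1) (D : Fin (n + 2) → Set (Set ι)) (hD : ∀ j, IsLowerSet (D j))
    (hsh : ∀ e, (∃ i j, i ≠ j ∧ secAt e false (D i) ≠ secAt e true (D i) ∧ secAt e false (D j) ≠ secAt e true (D j)) →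
      ∀ b : Bool, SuppZeroFlag (n + 2) (fun j => secAt e b (D j))) :
    sahiE (bernoulliWeight p) (n + 2) (fun j => ind (D j)) = 0 ↔ SuppZeroFlag (n + 2) D :=
  (sahiE_ind_lower_nonneg_and_eq_zero_iff_of_sharedFaceVanishing hn p hp D hD hsh).2

/-- Strict form for shared-face-vanishing decreasing families. [this work] -/
theorem sahiE_ind_lower_pos_of_sharedFaceVanishing {n : ℕ} (hn : n + 2 ≤ 6) (p : ι → unitInterval)
    (hp : ∀ e, (p e : ℝ) ∈ Set.Ioo (0 : ℝ) 1) (D : Fin (n + 2) → Set (Set ι)) (hD : ∀ j, IsLowerSet (D j))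
    (hsh : ∀ e, (∃ i j, i ≠ j ∧ secAt e false (D i) ≠ secAt e true (D i) ∧ secAt e false (D j) ≠ secAt e true (D j)) →
      ∀ b : Bool, SuppZeroFlag (n + 2) (fun j => secAt e b (D j))) (hZ : ¬ SuppZeroFlag (n + 2) D) :
    0 < sahiE (bernoulliWeight p) (n + 2) (fun j => ind (D j)) :=
  lt_of_le_of_ne (sahiE_ind_lower_nonneg_of_sharedFaceVanishing hn p hp D hD hsh)
    (fun h0 => hZ ((sahiE_ind_lower_eq_zero_iff_of_sharedFaceVanishing hn p hp D hD hsh).1 h0.symm))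

end Pointwise

/-! ### 3. Graph form -/

namespace Pointwise

open Literature.Probability.Percolation

variable {V : Type} [Fintype V]

/-- **Graph form**: `k = n+2 ≤ 6` group separations such that at every edge pivotal for at least two of them both single-edge minors form a zero flag:
at every interior weight vector `E_k ≥ 0`, and `E_k = 0` iff the tuple is a zero flag. [this work] -/
theorem sahiE_groupSep_nonneg_and_eq_zero_iff_of_sharedFaceVanishing {n : ℕ} (hn : n + 2 ≤ 6) (w : Sym2 V → unitInterval)
    (hw : ∀ e, (w e : ℝ) ∈ Set.Ioo (0 : ℝ) 1) (X Y : Fin (n + 2) → Set V)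
    (hsh : ∀ e : Sym2 V, (∃ i j, i ≠ j ∧
        secAt e false {ω : BondConfig V | ∀ x ∈ X i, ∀ y ∈ Y i, ¬ (openGraph ω).Reachable x y} ≠
          secAt e true {ω : BondConfig V | ∀ x ∈ X i, ∀ y ∈ Y i, ¬ (openGraph ω).Reachable x y} ∧
        secAt e false {ω : BondConfig V | ∀ x ∈ X j, ∀ y ∈ Y j, ¬ (openGraph ω).Reachable x y} ≠
          secAt e true {ω : BondConfig V | ∀ x ∈ X j, ∀ y ∈ Y j, ¬ (openGraph ω).Reachable x y}) →
      ∀ b : Bool, SuppZeroFlag (n + 2) (fun j => secAt e b {ω : BondConfig V | ∀ x ∈ X j, ∀ y ∈ Y j, ¬ (openGraph ω).Reachable x y})) :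
    0 ≤ sahiE (bernoulliWeight w) (n + 2) (fun j => ind {ω : BondConfig V | ∀ x ∈ X j, ∀ y ∈ Y j, ¬ (openGraph ω).Reachable x y}) ∧
      (sahiE (bernoulliWeight w) (n + 2) (fun j => ind {ω : BondConfig V | ∀ x ∈ X j, ∀ y ∈ Y j, ¬ (openGraph ω).Reachable x y}) = 0 ↔
        SuppZeroFlag (n + 2) fun j => {ω : BondConfig V | ∀ x ∈ X j, ∀ y ∈ Y j, ¬ (openGraph ω).Reachable x y}) :=
  sahiE_ind_lower_nonneg_and_eq_zero_iff_of_sharedFaceVanishing hn w hw _ (fun j => isLowerSet_groupSep (X j) (Y j)) hsh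

end Pointwise

end Summit.CriticalPhenomena.PercolationContinuityZ3.Theorems
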